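import Summits.BirchSwinnertonDyer.BirchSwinnertonDyer.Theses.KatoDescentPotSupersingular
import Summits.BirchSwinnertonDyer.Rank1Residual.O6.X3KatoMemberBoundExactCountUpper
import HarnessLib

/-!
# Route `KatoDescentPotSupersingular` (rung K9, cell `bsd-potss`): the reducible-defect child
# `WildUpperReducibleDefect` (item stmt-BirchSwinnertonDyer-19190) of crux U₀ FROM THE SHARPENED HULL
# READINGS — its `ℤ/9`-member / odd-parity rows need no separate input (a `--supports … --as helper` file)

The reshaped crux U₀ `WildUpperDefectRankZero` (tenure g10, route rev 2) has two children: the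
irreducible 3-adic-tower-NON-surjective rows (`WildUpperNonsurjTower`, 19189) and the REDUCIBLE defect
rows (`WildUpperReducibleDefect`, 19190: `E[3]` reducible with a `ℤ/9`-member in the class or odd
`ord₃ #Ш_an`). The second child exists only because o6-r1's member bound T-X3K carries a slack
`3·ord_p #tors(W_K)` while BSD carries `2·ord_p #tors`: the consumer
`x3PotGoodRankZeroUpperOfSmallClassTorsion_of_katoMember` absorbs one unit of slack by Cassels–Tate
parity and fails on a `ℤ/9` member or odd parity. Seat kmc part 14
(`O6/X3KatoMemberBoundExactCount{,Upper}.lean`) shows the slack is an artefact of reading Kato's Prop. 14.16 (2)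
at face value: with `#H¹(ℤ[1/p],T)_tors` in place of `#H⁰(ℚ,T⊗ℚ/ℤ)` and the exact Lemma T (Poitou–Tate
for `Sel ⊂ S(T)`; the cokernel is `p^{t−t₁}`) the rank-`0` count at Kato's member is EXACT,
`ord₃ #Ш_an(W_K) = ord₃ #Ш(W_K) + m`, `m ≥ 0` by the hull divisibility (Wuthrich Lemma 14 at `(3)`,
Kato 12.5 (3) off `(3)`), so the UPPER half holds at `W_K` and, by Cassels, at every member — on EVERY
reducible wild row, `ℤ/9` member or not, any parity. This file restates that with the ROUTE DECL as its
type: `WildUpperReducibleDefect` over Reading M1 (`KatoHull.MemberRealizable`), Reading M2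
(`KatoHull.DivisibilityReading`), Reading M3♯ (`KatoHull.ExactCountReading`) and the named facts
Cassels / GZK / modularity — the SAME readings as crux M (`ReducibleKatoMember`, part 12/12b). CONDITIONAL
(audit `proof.conditional`); the item is NOT closed. Seat `bsd-potss-kmc` generation 7.

References: [Kato2004Asterisque] 8.2 (p. 180), Thm. 12.5 (3), 12.6 (p. 222), (14.9.3) (p. 240), §14.14
(p. 243), Prop. 14.16 (2) and proof (pp. 244–245); [Wuthrich2014] §3.2, Lemma 14 (pp. 394–396);
[MazurRubin2004] Thm. 2.3.4; [Cassels1965ArithmeticVIII]; [Miller2011LMS] Def. 1.1.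
-/

set_option autoImplicit false
-- sibling precedent (`KatoDescentPotSupersingularAssembly.lean`): the directory name repeats the summit name
set_option linter.dupNamespace false

noncomputable section

open scoped Classical

namespace Summit.BirchSwinnertonDyer.BirchSwinnertonDyer.Theorems

open WeierstrassCurve Literature.NumberTheory.EllipticCurves
  Literature.NumberTheory.EllipticCurves.Rank1Residual
  Literature.NumberTheory.EllipticCurves.Rank1Residual.Typed
  Summit.BirchSwinnertonDyer.Rank1Residual.Additive
  Summit.BirchSwinnertonDyer.Rank1Residual
  Summit.BirchSwinnertonDyer.BirchSwinnertonDyer.Theses.KatoDescentPotSupersingular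

variable {IsHullOf : ∀ (W : WeierstrassCurve ℚ) [W.IsElliptic] [W.IsGloballyMinimal] (p : ℕ)
  [Fact p.Prime], KatoHullDescentDatum p → Prop}

/-- **The upper half on EVERY reducible wild row of analytic rank `0`** (`ClassO6 W 3`, `W[3]` reducible
⟹ `MissingUpperBoundAt W 3`), over the sharpened hull readings M1, M2, M3♯ and Cassels / GZK /
modularity — `O6.x3PotGoodRankZeroUpper_of_hullReadingsSharp` at `p = 3` (`ClassO6` gives `3 ≠ 2`,
additivity and `ord₃ j ≥ 0`). No `ℤ/9` / parity hypothesis. Conditional; nothing asserted.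
[cite: Kato2004Asterisque, Thm. 12.6 (p. 222), Prop. 14.16 (2) (p. 244)] [cite: Wuthrich2014, Lemma 14 (p. 396)]
[cite: Cassels1965ArithmeticVIII] -/
theorem wildUpperReducible_of_hullReadingsSharp (hM : KatoHull.MemberRealizable IsHullOf)
    (hD : KatoHull.DivisibilityReading IsHullOf) (hC : KatoHull.ExactCountReading IsHullOf)
    (hCassels : bsdRHS_eq_of_isIsogenous) (hGZK : rank_eq_analyticRank_of_analyticRank_le_one)
    (hmod : hasEntireLFunction_rat)
    (W : WeierstrassCurve ℚ) [W.IsElliptic] [W.IsGloballyMinimal] [Fact (3 : ℕ).Prime]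
    (hr : W.analyticRank = 0) (hO : ClassO6 W 3) (hred : ¬ W.HasIrreducibleModPGaloisRep 3) :
    MissingUpperBoundAt W 3 :=
  O6.x3PotGoodRankZeroUpper_of_hullReadingsSharp hM hD hC hCassels hGZK hmod W 3 hO.1 hO.2.1.1
    hO.2.1.2 hO.padicValRat_j_nonneg hred hr

/-- **The child item `WildUpperReducibleDefect` (stmt-BirchSwinnertonDyer-19190) over the sharpened hull
readings** (type = the route decl verbatim; its defect hypothesis — a `ℤ/9` member or odd `ord₃ #Ш_an` —
is not used). Conditional over displayed readings / named facts; the item is NOT closed.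
[cite: Kato2004Asterisque, Thm. 12.6 (p. 222), §14.14 (p. 243), Prop. 14.16 (2) (p. 244)]
[cite: Wuthrich2014, §3.2 and Lemma 14 (pp. 394–396)] [cite: Cassels1965ArithmeticVIII] -/
theorem wildUpperReducibleDefect_of_hullReadingsSharp (hM : KatoHull.MemberRealizable IsHullOf)
    (hD : KatoHull.DivisibilityReading IsHullOf) (hC : KatoHull.ExactCountReading IsHullOf)
    (hCassels : bsdRHS_eq_of_isIsogenous) (hGZK : rank_eq_analyticRank_of_analyticRank_le_one)
    (hmod : hasEntireLFunction_rat) :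
    Summit.BirchSwinnertonDyer.BirchSwinnertonDyer.Theses.KatoDescentPotSupersingular.WildUpperReducibleDefect :=
  fun W _ _ _ hr hO hred _ ↦
    wildUpperReducible_of_hullReadingsSharp hM hD hC hCassels hGZK hmod W hr hO hred

end Summit.BirchSwinnertonDyer.BirchSwinnertonDyer.Theorems

end
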